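import Mathlib
import Summits.KontsevichZagierPeriods.Zeta5Search.Elimination.HalfShiftGauge
import Summits.KontsevichZagierPeriods.Zeta5Search.WedgeDictionaryBridge
import Summits.KontsevichZagierPeriods.Zeta5Search.WedgeDictionaryVanishing
import HarnessLib

/-!
# The bridge on the ghost face `{1,6}` (E-L20; fam-elim gen 24)

HONEST FRAMING: systematic search; no irrationality claim unless certified — identities among the rational Taylor
data `U, V, W` of the Ball–Rivoal family and gen-1's dictionary values `(Q, P̂, P)`; nothing about sizes/irrationality.

OUR work (Summit side; `families/elim/FAMILY.md` §17).  The boundary of gen-1's four-term node `DictBridge`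
(`WedgeDictionaryBridge.lean`; interior = `Elimination/DictBridge.dictBridge_at`, E-L19c-2b₂) consists of the level-`1`
clusters and of the GHOST-FACE clusters: under the four `RegionHyp`s of a bridge cluster `{c, c+e₇, Hc, DSc}` the only
non-edge pair sum that can exceed the level is `c₁ + c₆`, and then `c₁ = c₆ = (c₀+1)/2` (`c₀` odd).  On that face
* `U ≡ 0` by the pole-order drop (`coeffU_eq_zero_of_pair'`: the tree's `quadM3_eq_zero_of_pair` with `d ≥ 0` relaxed
  to `d ≥ −1`, which is all its proof uses — needed at `DSc + e₇` when `d(c) = 1`), so the wedge coordinates `U∧W`,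
  `U∧V` vanish at `c`, `c+e₇`, `DSc`, and gen-1's `bridgeHalf(c) = (c₀+1−c₇)(c₀+1−c₁−c₆) = 0`;
* hence the bridge is ONE scalar three-term relation for `X = V∧W = casVW` on `{c, c+e₇, DSc}`; with the gauge ratios
  `rhoB_bump6`, `rhoB_dsShift` it reads `λ·(c₀−1−c₂−c₃−c₇)·X(c) + d/(m₄m₅)·X(c+e₇) = d/((c₄+1)(c₅+1))·X(DSc)`
  (`λ = (c₇+1)(c₀+1−c₇)`, `m_k = c₀−c_k−c₇`) — formally the ρ-free bridge `halfShiftBridge` at `pr = 0`;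
* the face values of `X` obey two first-order recurrences (node `CasVWFace16`, OPEN — the ratios of the closed form
  CF-VW-face found by this seat and checked EXACTLY on 4547 face points, levels `≤ 11`); substituting them the bridge
  becomes `(c₇+1)·[(u+1)(u−1−c₂−c₃) − (u−c₂)(u−c₃) + (c₂+1)(c₃+1)] = 0`, `u = c₀−c₇`, an identity
  (`face_assemble`, one `linear_combination`; certificate `HOME/pub-zeta5-fam-elim/g24/bd/check_face_cert2.py`).
So `dictBridgeFace16_of : CasVWFace16 → DictBridgeFace16` (the face stratum of gen-1's node, stated here as a node,
PROVED modulo `CasVWFace16`).  EXACT evidence (engine `pub-zeta5-fam-elim/g23/e19`): gen-1's `DictBridge` holds at all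
6628 bridge clusters of levels `1…5` (6448 interior, 177 face, 3 of level `1`; `g24/bd/level_sweep.py`).
What this is NOT: `CasVWFace16` is not proved (expected: Abel-lemma induction on the face, as for CF-M3 in
`WedgeDictionaryFace*`); the three level-`1` clusters are not treated; nothing about sizes, denominators or
irrationality; the class verdict is unchanged (T1 NO / T2 NO / T4 YES).
-/


open Finset Polynomial

namespace Summit.KontsevichZagierPeriods.Zeta5Search.Elimination

open Summit.KontsevichZagierPeriods.Zeta5Search.DualSeries
open Summit.KontsevichZagierPeriods.Zeta5Search.WedgeDictionary
open Summit.KontsevichZagierPeriods.Zeta5Search.SymmetricGauge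
open Literature.NumberTheory.Irrationality.BrownZudilin2022 (bOfA Converges QOf)
open Literature.NumberTheory.Transcendental (BallRivoal.poch)
open Literature.NumberTheory.Transcendental.BallRivoal (pochPoly eval_pochPoly pfEval)
open Literature.NumberTheory.Irrationality.CressonFischlerRivoal2008 (exists_pf_data)

/-! ### 1. The pole-order drop with `d ≥ −1` -/

/-- **Pole-order drop, `d ≥ −1`.**  The tree's `quadM3_eq_zero_of_pair` (if two parameters have
`b_{j+1} + b_{k+1} ≥ b₀ + 1`, all `b_i ≤ b₀`, then `(X)_{b₀+1}² ∣ numPoly b` and `U(b) = 0`) with its hypothesis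
`0 ≤ d(b)` relaxed to `−1 ≤ d(b)`: its proof only uses `Σ_j b_j ≤ 3b₀ + 1` (the degree bound keeping `R_b` proper).
Proof copied from `WedgeDictionaryVanishing.quadM3_eq_zero_of_pair` (gen-1), `U`-part only. -/
theorem coeffU_eq_zero_of_pair' (b : ℕ → ℤ) (hb : InBox b) (hd : -1 ≤ dOf b) (hle : ∀ j ∈ Icc 1 7, b j ≤ b 0)
    {j k : ℕ} (hj : j < 7) (hk : k < 7) (hjk : j ≠ k) (hsum : b 0 < b (j + 1) + b (k + 1)) :
    coeffU b = 0 := by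
  obtain ⟨h0, hbox⟩ := hb
  have hB : (((b 0).toNat : ℕ) : ℤ) = b 0 := Int.toNat_of_nonneg h0
  have hnj : (((b (j + 1)).toNat : ℕ) : ℤ) = b (j + 1) := Int.toNat_of_nonneg (hbox j (mem_range.2 hj)).1
  have hnk : (((b (k + 1)).toNat : ℕ) : ℤ) = b (k + 1) := Int.toNat_of_nonneg (hbox k (mem_range.2 hk)).1
  have hjle : b (j + 1) ≤ b 0 := hle (j + 1) (by rw [mem_Icc]; omega)
  have hkle : b (k + 1) ≤ b 0 := hle (k + 1) (by rw [mem_Icc]; omega)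
  set B := (b 0).toNat with hBdef
  -- (1) divisibility of the numerator by `(X)_{B+1}²`
  have hdvd : pochPoly 0 (B + 1) ^ 2 ∣ numPoly b := by
    unfold numPoly
    set F : ℕ → ℚ[X] := fun i =>
      pochPoly 0 (b (i + 1)).toNat * pochPoly ((b 0 - b (i + 1) + 1 : ℤ) : ℚ) (b (i + 1)).toNat with hF
    refine Dvd.dvd.mul_left ?_ _
    have hsplit : ∏ i ∈ range 7, F i = F j * (F k * ∏ i ∈ ((range 7).erase j).erase k, F i) := by
      rw [mul_prod_erase ((range 7).erase j) F (mem_erase.2 ⟨fun h => hjk h.symm, mem_range.2 hk⟩),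
        mul_prod_erase (range 7) F (mem_range.2 hj)]
    rw [hsplit, ← mul_assoc, pow_two]
    refine Dvd.dvd.mul_right ?_ _
    have e : F j * F k =
        (pochPoly 0 (b (j + 1)).toNat * pochPoly ((b 0 - b (k + 1) + 1 : ℤ) : ℚ) (b (k + 1)).toNat) *
          (pochPoly 0 (b (k + 1)).toNat * pochPoly ((b 0 - b (j + 1) + 1 : ℤ) : ℚ) (b (j + 1)).toNat) := by
      simp only [hF]; ring
    rw [e]
    refine mul_dvd_mul (pochPoly_zero_dvd B _ _ _ ?_ (by omega) (by omega))
      (pochPoly_zero_dvd B _ _ _ ?_ (by omega) (by omega))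
    · rw [show (b 0 - b (k + 1) + 1 : ℤ) = ((B + 1 - (b (k + 1)).toNat : ℕ) : ℤ) by omega, Int.cast_natCast]
    · rw [show (b 0 - b (j + 1) + 1 : ℤ) = ((B + 1 - (b (j + 1)).toNat : ℕ) : ℤ) by omega, Int.cast_natCast]
  obtain ⟨M, hM⟩ := hdvd
  -- (2) degree of the cofactor
  have hq : (pochPoly 0 (B + 1)).Monic := by
    unfold pochPoly; exact monic_prod_of_monic _ _ fun s _ => monic_X_add_C _
  have hqdeg : (pochPoly 0 (B + 1)).natDegree = B + 1 := by
    unfold pochPoly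
    rw [natDegree_prod_of_monic _ _ fun s _ => monic_X_add_C _]
    simp only [natDegree_X_add_C, sum_const, card_range, smul_eq_mul, mul_one]
  have hsum' : ∑ i ∈ range 7, b (i + 1) ≤ 3 * b 0 + 1 := by unfold dOf at hd; omega
  have hdegN := natDegree_numPoly_add_two_le b ⟨h0, hbox⟩ hsum'
  have hMdeg : (M.comp (X + C 1)).degree < ((4 * (B + 1) : ℕ) : WithBot ℕ) := by
    by_cases hM0 : M = 0
    · rw [hM0, zero_comp, degree_zero]; exact WithBot.bot_lt_coe _
    · have hq0 : pochPoly 0 (B + 1) ^ 2 ≠ 0 := pow_ne_zero _ hq.ne_zero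
      have hdegM : (numPoly b).natDegree = 2 * (B + 1) + M.natDegree := by
        rw [hM, natDegree_mul hq0 hM0, natDegree_pow, hqdeg]
      have hnat : (M.comp (X + C 1)).natDegree = M.natDegree := by
        rw [natDegree_comp, natDegree_X_add_C, mul_one]
      exact degree_le_natDegree.trans_lt (by rw [hnat]; exact_mod_cast (by omega))
  -- (3) partial-fraction data of pole order ≤ 4 for the cofactor, padded to six orders, are data of `R_b`
  obtain ⟨c4, hc4⟩ := exists_pf_data B 4 (by norm_num) _ hMdeg
  set c6 : ℕ → ℕ → ℚ := fun o p => if o < 4 then c4 o p else 0 with hc6def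
  have hc6 : IsPFData b c6 := by
    intro t ht
    have hpoch : BallRivoal.poch (t + 1) (B + 1) ≠ 0 := by
      unfold BallRivoal.poch
      exact prod_ne_zero_iff.2 fun s hs h => ht s (Nat.lt_succ_iff.1 (mem_range.1 hs)) (by linarith)
    have h64 : pfEval B 6 c6 t = pfEval B 4 c4 t := by
      unfold pfEval
      refine sum_congr rfl fun p _ => ?_
      rw [sum_range_succ, sum_range_succ]
      simp only [hc6def, show ¬ (4:ℕ) < 4 by norm_num, show ¬ (5:ℕ) < 4 by norm_num, if_false, zero_div, add_zero]
      exact sum_congr rfl fun o ho => by rw [if_pos (mem_range.1 ho)]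
    rw [h64, hc4 t ht, hM]
    simp only [eval_comp, eval_mul, eval_pow, eval_add, eval_X, eval_C, eval_pochPoly, add_zero]
    rw [div_eq_div_iff (pow_ne_zero _ hpoch) (pow_ne_zero _ hpoch)]
    ring
  -- (4) uniqueness of the data: `U(b) = Σ_p c6 4 p = 0`
  rw [coeffU_eq hc6]
  exact sum_eq_zero fun p _ => by simp [hc6def]

/-- `U = 0` on the ghost face `{1,6}`: `x₀ < x₁ + x₆`, weak box, `d(x) ≥ −1`, all `x_j ≤ x₀`. -/
theorem coeffU_face16 (x : ℕ → ℤ) (hx : InBox x) (hd : -1 ≤ dOf x) (hle : ∀ j ∈ Icc 1 7, x j ≤ x 0)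
    (h16 : x 0 < x 1 + x 6) : coeffU x = 0 :=
  coeffU_eq_zero_of_pair' x hx hd hle (j := 0) (k := 5) (by norm_num) (by norm_num) (by norm_num)
    (by simpa using h16)

/-- If `U(x) = U(x+e₇) = 0` then the slot-7 wedge coordinates `U∧W`, `U∧V` vanish at `x`. -/
theorem casU_eq_zero {x : ℕ → ℤ} (hU : coeffU x = 0) (hU' : coeffU (bump x 6) = 0) :
    casUW x = 0 ∧ casUV x = 0 := by
  unfold casUW casUV
  rw [hU, hU']
  constructor <;> ring

/-! ### 2. The face recurrences of `V∧W` (node) -/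

/-- **CF-VW on the ghost face — the two ratios (OPEN; INTERNALLY MINTED, stated here).**  For `c` on the face
`c₁ = c₆ = (c₀+1)/2` with `d(c) ≥ 1`, `c_k ≤ (c₀−1)/2` (`k = 2,3,4,5`) and `c₇ ≤ (c₀−3)/2`, the slot-7 wedge
coordinate `X = casVW = V∧W` satisfies `X(c+e₇)·d(c) = −(c₇+1)·∏_{k∈{2,3,4,5}}(c₀−c_k−c₇)·X(c)` and
`X(DSc)·d(c) = −∏_{k∈{2,3,4,5,7}}(c_k+1)·X(c)` (`DSc = dsShift c`).  These are the two ratios, along `e₇` and along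
the diagonal shift, of the CLOSED FORM found by fam-elim g24 (2026-08-21) and verified EXACTLY (rational arithmetic on
the partial fractions) at all 4397 points `c₁ = c₆ = (c₀+1)/2`, `0 ≤ c_k ≤ (c₀−1)/2 (k ∈ S)`, `d(c) ≥ 0` of levels
`c₀ ≤ 9` and at 150 of the 7720 of level `11`, constant `−2` throughout:
`casVW(c) = −2·(−1)^{Σ_{k∈S} c_k}·∏_{k∈S} c_k!·d(c)! / ∏_{k<m∈S} (c₀−c_k−c_m)!`, `S = {2,3,4,5,7}` (at `c = (1;1,0,0,0,0,1,0)`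
it gives gen-1's level-1 ghost datum `P = ρ·casVW = −1/2`); the two ratios AS TYPED below were re-checked directly at
all 939 points of this node's hypothesis domain of levels `3,5,7` and at 200 of the 2479 of level `9`
(`face16_node_check.py`, 0 failures).  On the face `U ≡ 0`, so
`(W, V)` are the Taylor data of the reduced well-poised family `(2X+c₀)∏_{k∈S}(X)_{c_k}(X+c₀−c_k+1)_{c_k}/(X)_{c₀+1}⁴`
and `casVW` is its full Casoratian; the expected proof is the Abel-lemma induction of `WedgeDictionaryFace*` (CF-M3).
NOT a claim beyond the exact checks recorded in `HOME/pub-zeta5-fam-elim/g24/bd/`. -/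
@[conjecture] def CasVWFace16 : Prop :=
  ∀ c : ℕ → ℤ, InBox c → 2 * c 1 = c 0 + 1 → 2 * c 6 = c 0 + 1 → 1 ≤ dOf c →
    2 * c 2 + 1 ≤ c 0 → 2 * c 3 + 1 ≤ c 0 → 2 * c 4 + 1 ≤ c 0 → 2 * c 5 + 1 ≤ c 0 → 2 * c 7 + 3 ≤ c 0 →
      casVW (bump c 6) * (dOf c : ℚ) =
          -(((c 7 : ℚ) + 1) * (((c 0 : ℚ) - c 2 - c 7) * ((c 0 : ℚ) - c 3 - c 7) * ((c 0 : ℚ) - c 4 - c 7) *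
            ((c 0 : ℚ) - c 5 - c 7))) * casVW c ∧
        casVW (dsShift c) * (dOf c : ℚ) =
          -(((c 2 : ℚ) + 1) * ((c 3 : ℚ) + 1) * ((c 4 : ℚ) + 1) * ((c 5 : ℚ) + 1) * ((c 7 : ℚ) + 1)) * casVW c

/-! ### 3. The scalar skeleton on the face -/

/-- The scalar skeleton of the face bridge: the gauge ratios `R3` (`rhoB_bump6`), `R1` (`rhoB_dsShift`, with
`F = ∏_{j∈{1,4,5,6,7}}(c_j+1)`), the face recurrences `X7`, `XD` of `CasVWFace16`, the face equation `c₁ + c₆ = c₀ + 1`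
and gen-1's coefficients `α = bridgeBase`, `β = bridgeSlot`, `δ = bridgeApex` give `α·ρX + β·ρ₇X₇ + δ·ρ_D X_D = 0`
after cancelling `d·(c₇+1)·∏_{k∈{3,4,5,6}}(c₀−c_k−c₇)·F ≠ 0` (one `linear_combination`; certificate checked outside
Lean, `HOME/pub-zeta5-fam-elim/g24/bd/check_face_cert2.py`). -/
theorem face_assemble {N c1 c2 c3 c4 c5 c6 c7 r r7 rD x x7 xD d F α β δ : ℚ}
    (hface : c1 + c6 = N + 1)
    (R3 : r * d = -((c7 + 1) * ((N - c3 - c7) * (N - c4 - c7) * (N - c5 - c7) * (N - c6 - c7)) * r7))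
    (R1 : rD * F = -(d * r)) (hF : F = (c1 + 1) * (c4 + 1) * (c5 + 1) * (c6 + 1) * (c7 + 1))
    (X7 : x7 * d = -((c7 + 1) * ((N - c2 - c7) * (N - c3 - c7) * (N - c4 - c7) * (N - c5 - c7))) * x)
    (XD : xD * d = -((c2 + 1) * (c3 + 1) * (c4 + 1) * (c5 + 1) * (c7 + 1)) * x)
    (hα : α = (N + 1 - c7) * (2 * N - c1 - c2 - c3 - c6 - c7)) (hβ : β = -((N - c3 - c7) * (N - c6 - c7)))
    (hδ : δ = (c1 + 1) * (c6 + 1))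
    (hd : d ≠ 0) (hs7 : c7 + 1 ≠ 0) (hm3 : N - c3 - c7 ≠ 0) (hm4 : N - c4 - c7 ≠ 0) (hm5 : N - c5 - c7 ≠ 0)
    (hm6 : N - c6 - c7 ≠ 0) (hF0 : F ≠ 0) :
    α * (r * x) + β * (r7 * x7) + δ * (rD * xD) = 0 := by
  have key : (α * (r * x) + β * (r7 * x7) + δ * (rD * xD)) *
      (d * (c7 + 1) * ((N - c3 - c7) * (N - c4 - c7) * (N - c5 - c7) * (N - c6 - c7)) * F) = 0 := by
    rw [hα, hβ, hδ]
    linear_combination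
      (-((N - c3 - c7) * (N - c6 - c7)) * x7 * F * d) * R3 +
      ((N - c3 - c7) * (N - c6 - c7) * F * d * r) * X7 +
      ((c1 + 1) * (c6 + 1) * xD * d * (c7 + 1) *
        ((N - c3 - c7) * (N - c4 - c7) * (N - c5 - c7) * (N - c6 - c7))) * R1 +
      (-((c1 + 1) * (c6 + 1)) * d * r * (c7 + 1) *
        ((N - c3 - c7) * (N - c4 - c7) * (N - c5 - c7) * (N - c6 - c7))) * XD +
      (-(r * x * d * (c7 + 1) * ((N - c3 - c7) * (N - c4 - c7) * (N - c5 - c7) * (N - c6 - c7)) *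
        (N + 1 - c7) * F)) * hface +
      (-(r * x * d * (c7 + 1) * ((N - c3 - c7) * (N - c4 - c7) * (N - c5 - c7) * (N - c6 - c7)) *
        ((c2 + 1) * (c3 + 1)))) * hF
  have hK : d * (c7 + 1) * ((N - c3 - c7) * (N - c4 - c7) * (N - c5 - c7) * (N - c6 - c7)) * F ≠ 0 :=
    mul_ne_zero (mul_ne_zero (mul_ne_zero hd hs7)
      (mul_ne_zero (mul_ne_zero (mul_ne_zero hm3 hm4) hm5) hm6)) hF0
  exact (mul_eq_zero.1 key).resolve_right hK

/-! ### 4. The face stratum of gen-1's node -/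

/-- **The ghost-face stratum of gen-1's `DictBridge` (node; PROVED below modulo `CasVWFace16`).**  gen-1's four-term
relation at the bridge clusters whose base `c = b(a)` has `c₁ + c₆ > c₀` (then `c₁ = c₆ = (c₀+1)/2`; this is the whole
boundary of `DictBridge` above level `1`, see the module docstring).  Stated as a node so that the reduction of
`Elimination/DictBridge.DictBridgeBoundary` to it and to the level-`1` clusters can cite it by name. -/
@[conjecture] def DictBridgeFace16 : Prop :=
  ∀ (a : Fin 8 → ℤ) (j₀ j₁ j₂ j₃ : ℕ), bOfA a 0 < bOfA a 1 + bOfA a 6 →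
    RegionHyp a j₀ → RegionHyp (a - slotDown 7) j₁ → RegionHyp (a + halfUp457) j₂ → RegionHyp (a + dsUp) j₃ →
      DictFourTerm (bridgeBase (bOfA a)) (bridgeSlot (bOfA a)) (bridgeHalf (bOfA a)) (bridgeApex (bOfA a))
        a (a - slotDown 7) (a + halfUp457) (a + dsUp) j₀ j₁ j₂ j₃

/-- **gen-1's `DictBridge` at every ghost-face cluster, from the face recurrences of `V∧W`.** -/
theorem dictBridge_face16_at (hX : CasVWFace16) (a : Fin 8 → ℤ) (j₀ j₁ j₂ j₃ : ℕ)
    (h16 : bOfA a 0 < bOfA a 1 + bOfA a 6) (H₀ : RegionHyp a j₀)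
    (H₁ : RegionHyp (a - slotDown 7) j₁) (H₂ : RegionHyp (a + halfUp457) j₂) (H₃ : RegionHyp (a + dsUp) j₃) :
    DictFourTerm (bridgeBase (bOfA a)) (bridgeSlot (bOfA a)) (bridgeHalf (bOfA a)) (bridgeApex (bOfA a))
      a (a - slotDown 7) (a + halfUp457) (a + dsUp) j₀ j₁ j₂ j₃ := by
  obtain ⟨hQ0, hPh0, hP0⟩ := dict_values H₀
  obtain ⟨hQ1, hPh1, hP1⟩ := dict_values H₁
  obtain ⟨hQ3, hPh3, hP3⟩ := dict_values H₃
  obtain ⟨-, hconv, hreg, -, -⟩ := H₀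
  obtain ⟨-, hconv1, -, -, -⟩ := H₁
  obtain ⟨-, hconv2, -, -, -⟩ := H₂
  obtain ⟨-, -, -, hd3, -⟩ := H₃
  set c := bOfA a with hc
  -- the dual coordinates of the other points: `c + e₇`, `Hc`, `DSc`
  have h7b : ∀ j, j ≤ 7 → bOfA (a - slotDown 7) j = bump c 6 j := fun j hj => by
    rw [bOfA_sub_slotDown7 a j hj]
    by_cases h : j = 7
    · rw [if_pos h, h, bump6_seven]
    · rw [if_neg h, bump_of_ne c (show j ≠ 6 + 1 by omega)]
  have hHb : ∀ j, j ≤ 7 → bOfA (a + halfUp457) j = hShift c j := fun j hj => by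
    rw [bOfA_add_halfUp457 a j hj]
    unfold hShift
    rfl
  have hDb : ∀ j, j ≤ 7 → bOfA (a + dsUp) j = dsShift c j := fun j hj => by
    rw [bOfA_add_dsUp a j hj, dsShift_apply]
  -- facts at `c`: half box, face equations, edge pairs, `d ≥ 1`
  have hcs : ∀ k, 1 ≤ k → k ≤ 7 → 0 ≤ c k ∧ 2 * c k ≤ c 0 + 1 := fun k h1 h7 =>
    hreg k (mem_Icc.2 ⟨h1, h7⟩)
  obtain ⟨p1, p2, p3, p4, p5, p6, p7⟩ : (0 ≤ c 1 ∧ 2 * c 1 ≤ c 0 + 1) ∧ (0 ≤ c 2 ∧ 2 * c 2 ≤ c 0 + 1) ∧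
      (0 ≤ c 3 ∧ 2 * c 3 ≤ c 0 + 1) ∧ (0 ≤ c 4 ∧ 2 * c 4 ≤ c 0 + 1) ∧ (0 ≤ c 5 ∧ 2 * c 5 ≤ c 0 + 1) ∧
      (0 ≤ c 6 ∧ 2 * c 6 ≤ c 0 + 1) ∧ (0 ≤ c 7 ∧ 2 * c 7 ≤ c 0 + 1) :=
    ⟨hcs 1 (by norm_num) (by norm_num), hcs 2 (by norm_num) (by norm_num), hcs 3 (by norm_num) (by norm_num),
      hcs 4 (by norm_num) (by norm_num), hcs 5 (by norm_num) (by norm_num), hcs 6 (by norm_num) (by norm_num),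
      hcs 7 (by norm_num) (by norm_num)⟩
  have h16' : c 0 < c 1 + c 6 := h16
  have hf1 : 2 * c 1 = c 0 + 1 := by omega
  have hf6 : 2 * c 6 = c 0 + 1 := by omega
  have hE : ∀ jk ∈ Epairs, c jk.1 + c jk.2 ≤ c 0 := epairs_le_of_converges a hconv
  obtain ⟨e12, e13, e14, e15⟩ : c 1 + c 2 ≤ c 0 ∧ c 1 + c 3 ≤ c 0 ∧ c 1 + c 4 ≤ c 0 ∧ c 1 + c 5 ≤ c 0 :=
    ⟨hE (1, 2) (by decide), hE (1, 3) (by decide), hE (1, 4) (by decide), hE (1, 5) (by decide)⟩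
  have hE7 : ∀ jk ∈ Epairs, bump c 6 jk.1 + bump c 6 jk.2 ≤ c 0 := fun jk hjk => by
    obtain ⟨-, h17, -, h27, -⟩ := epairs_bounds jk hjk
    have h := epairs_le_of_converges _ hconv1 jk hjk
    rw [h7b jk.1 h17, h7b jk.2 h27, h7b 0 (by norm_num), bump_zero] at h
    exact h
  have e37 : c 3 + (c 7 + 1) ≤ c 0 := by
    simpa [bump_of_ne c (show (3 : ℕ) ≠ 6 + 1 by omega), bump6_seven] using hE7 (3, 7) (by decide)
  have e57 : c 5 + (c 7 + 1) ≤ c 0 := by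
    simpa [bump_of_ne c (show (5 : ℕ) ≠ 6 + 1 by omega), bump6_seven] using hE7 (5, 7) (by decide)
  have e67 : c 6 + (c 7 + 1) ≤ c 0 := by
    simpa [bump_of_ne c (show (6 : ℕ) ≠ 6 + 1 by omega), bump6_seven] using hE7 (6, 7) (by decide)
  have h47 : c 4 + c 7 + 1 ≤ c 0 := by
    obtain ⟨v0, -, -, -, v4, -, -, v7⟩ := hShift_vals c
    have h := epairs_le_of_converges _ hconv2 (4, 7) (by decide)
    simp only at h
    rw [hHb 4 (by norm_num), hHb 7 (by norm_num), hHb 0 (by norm_num), v0, v4, v7] at h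
    omega
  have hcI : InBox c := ⟨by omega, fun j hj => by
    have := hcs (j + 1) (by omega) (by have := mem_range.1 hj; omega); omega⟩
  have hd : 1 ≤ dOf c := by rw [dOf_congr hDb, dOf_dsShift] at hd3; omega
  -- the four auxiliary points `c+e₇`, `c+2e₇`, `DSc`, `DSc+e₇`: box and `d`
  have hI1 : InBox (bump c 6) := inBox_bump6 c hcI (by omega)
  have hI2 : InBox (bump (bump c 6) 6) := inBox_bump6 _ hI1 (by rw [bump6_seven, bump_zero]; omega)
  have hI3 : InBox (dsShift c) := inBox_dsShift hcI
  have hI4 : InBox (bump (dsShift c) 6) :=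
    inBox_bump6 _ hI3 (by rw [dsShift_apply, dsShift_apply, if_neg (by omega), if_pos rfl]; omega)
  have hd1 : dOf (bump c 6) = dOf c - 1 := dOf_bump c (mem_range.2 (by norm_num))
  have hd2 : dOf (bump (bump c 6) 6) = dOf c - 2 := by
    rw [dOf_bump _ (mem_range.2 (by norm_num)), hd1]; ring
  have hd3' : dOf (dsShift c) = dOf c - 1 := dOf_dsShift c
  have hd4 : dOf (bump (dsShift c) 6) = dOf c - 2 := by
    rw [dOf_bump _ (mem_range.2 (by norm_num)), hd3']; ring
  -- `U = 0` at the five face points `c`, `c+e₇`, `c+2e₇`, `DSc`, `DSc+e₇`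
  have hU0 : coeffU c = 0 := coeffU_face16 c hcI (by omega)
    (fun j hj => by have hj' := mem_Icc.1 hj; have := hcs j hj'.1 hj'.2; omega) h16'
  have hU1 : coeffU (bump c 6) = 0 := coeffU_face16 _ hI1 (by omega)
    (fun j hj => by
      have hj' := mem_Icc.1 hj
      have := hcs j hj'.1 hj'.2
      by_cases h : j = 7
      · rw [h, bump6_seven, bump_zero]; omega
      · rw [bump_of_ne c (show j ≠ 6 + 1 by omega), bump_zero]; omega)
    (by rw [bump_zero, bump_of_ne c (show (1 : ℕ) ≠ 6 + 1 by omega), bump_of_ne c (show (6 : ℕ) ≠ 6 + 1 by omega)]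
        omega)
  have hU2 : coeffU (bump (bump c 6) 6) = 0 := coeffU_face16 _ hI2 (by omega)
    (fun j hj => by
      have hj' := mem_Icc.1 hj
      have := hcs j hj'.1 hj'.2
      by_cases h : j = 7
      · rw [h, bump6_seven, bump6_seven, bump_zero, bump_zero]; omega
      · rw [bump_of_ne _ (show j ≠ 6 + 1 by omega), bump_of_ne c (show j ≠ 6 + 1 by omega), bump_zero, bump_zero]
        omega)
    (by rw [bump_zero, bump_zero, bump_of_ne _ (show (1 : ℕ) ≠ 6 + 1 by omega),
          bump_of_ne c (show (1 : ℕ) ≠ 6 + 1 by omega), bump_of_ne _ (show (6 : ℕ) ≠ 6 + 1 by omega),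
          bump_of_ne c (show (6 : ℕ) ≠ 6 + 1 by omega)]
        omega)
  have hU3 : coeffU (dsShift c) = 0 := coeffU_face16 _ hI3 (by omega)
    (fun j hj => by
      have hj' := mem_Icc.1 hj
      have := hcs j hj'.1 hj'.2
      rw [dsShift_zero, dsShift_apply, if_neg (show j ≠ 0 by omega)]
      omega)
    (by rw [dsShift_zero, dsShift_apply c 1, dsShift_apply c 6, if_neg (show (1 : ℕ) ≠ 0 by omega),
          if_neg (show (6 : ℕ) ≠ 0 by omega)]
        omega)
  have hU4 : coeffU (bump (dsShift c) 6) = 0 := coeffU_face16 _ hI4 (by omega)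
    (fun j hj => by
      have hj' := mem_Icc.1 hj
      have := hcs j hj'.1 hj'.2
      by_cases h : j = 7
      · rw [h, bump6_seven, bump_zero, dsShift_zero, dsShift_apply, if_neg (show (7 : ℕ) ≠ 0 by omega)]; omega
      · rw [bump_of_ne _ (show j ≠ 6 + 1 by omega), bump_zero, dsShift_zero, dsShift_apply,
          if_neg (show j ≠ 0 by omega)]
        omega)
    (by rw [bump_zero, dsShift_zero, bump_of_ne _ (show (1 : ℕ) ≠ 6 + 1 by omega),
          bump_of_ne _ (show (6 : ℕ) ≠ 6 + 1 by omega), dsShift_apply c 1, dsShift_apply c 6,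
          if_neg (show (1 : ℕ) ≠ 0 by omega), if_neg (show (6 : ℕ) ≠ 0 by omega)]
        omega)
  obtain ⟨hUW0, hUV0⟩ := casU_eq_zero hU0 hU1
  obtain ⟨hUW1, hUV1⟩ := casU_eq_zero hU1 hU2
  obtain ⟨hUW3, hUV3⟩ := casU_eq_zero hU3 hU4
  have hγ0 : (bridgeHalf c : ℚ) = 0 := by
    have : bridgeHalf c = 0 := by
      unfold bridgeHalf
      rw [show c 0 + 1 - c 1 - c 6 = 0 by omega, mul_zero]
    rw [this, Int.cast_zero]
  obtain ⟨X7, XD⟩ := hX c hcI hf1 hf6 hd (by omega) (by omega) (by omega) (by omega) (by omega)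
  have R3 := rhoB_bump6 c hcI (by omega) hd hE7
  have R1 := rhoB_dsShift c hcI hd
  have hFd : ((([1, 4, 5, 6, 7] : List ℕ).map fun j => ((c j : ℚ) + 1)).prod) =
      ((c 1 : ℚ) + 1) * ((c 4 : ℚ) + 1) * ((c 5 : ℚ) + 1) * ((c 6 : ℚ) + 1) * ((c 7 : ℚ) + 1) := by
    simp only [List.map_cons, List.map_nil, List.prod_cons, List.prod_nil]
    ring
  have hα : (bridgeBase c : ℚ) = ((c 0 : ℚ) + 1 - c 7) * (2 * (c 0 : ℚ) - c 1 - c 2 - c 3 - c 6 - c 7) := by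
    simp only [bridgeBase]
    push_cast
    ring
  have hβ : (bridgeSlot c : ℚ) = -(((c 0 : ℚ) - c 3 - c 7) * ((c 0 : ℚ) - c 6 - c 7)) := by
    simp only [bridgeSlot]
    push_cast
    ring
  have hδ : (bridgeApex c : ℚ) = ((c 1 : ℚ) + 1) * ((c 6 : ℚ) + 1) := by
    simp only [bridgeApex]
    push_cast
    ring
  have hface : (c 1 : ℚ) + c 6 = c 0 + 1 := by exact_mod_cast (show c 1 + c 6 = c 0 + 1 by omega)
  -- non-vanishing of the cancelled product
  have hpos : ∀ z : ℤ, 1 ≤ z → (z : ℚ) ≠ 0 := fun z hz => by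
    have : (1 : ℚ) ≤ z := by exact_mod_cast hz
    exact ne_of_gt (by linarith)
  have hdq : (dOf c : ℚ) ≠ 0 := hpos (dOf c) hd
  have hs7 : (c 7 : ℚ) + 1 ≠ 0 := by exact_mod_cast hpos (c 7 + 1) (by omega)
  have hm3 : (c 0 : ℚ) - c 3 - c 7 ≠ 0 := by exact_mod_cast hpos (c 0 - c 3 - c 7) (by omega)
  have hm4 : (c 0 : ℚ) - c 4 - c 7 ≠ 0 := by exact_mod_cast hpos (c 0 - c 4 - c 7) (by omega)
  have hm5 : (c 0 : ℚ) - c 5 - c 7 ≠ 0 := by exact_mod_cast hpos (c 0 - c 5 - c 7) (by omega)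
  have hm6 : (c 0 : ℚ) - c 6 - c 7 ≠ 0 := by exact_mod_cast hpos (c 0 - c 6 - c 7) (by omega)
  have hF0 : ((([1, 4, 5, 6, 7] : List ℕ).map fun j => ((c j : ℚ) + 1)).prod) ≠ 0 := by
    have h1 : (c 1 : ℚ) + 1 ≠ 0 := by exact_mod_cast hpos (c 1 + 1) (by omega)
    have h4 : (c 4 : ℚ) + 1 ≠ 0 := by exact_mod_cast hpos (c 4 + 1) (by omega)
    have h5 : (c 5 : ℚ) + 1 ≠ 0 := by exact_mod_cast hpos (c 5 + 1) (by omega)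
    have h6 : (c 6 : ℚ) + 1 ≠ 0 := by exact_mod_cast hpos (c 6 + 1) (by omega)
    rw [hFd]
    exact mul_ne_zero (mul_ne_zero (mul_ne_zero (mul_ne_zero h1 h4) h5) h6) hs7
  -- rewrite the nine dictionary values at `c`, `c+e₇`, `DSc`
  rw [rhoOf_eq_rhoB, ← hc] at hQ0 hPh0 hP0
  rw [rhoOf_eq_rhoB] at hQ1 hPh1 hP1 hQ3 hPh3 hP3
  rw [rhoB_congr h7b, (cas_congr h7b).1] at hQ1
  rw [rhoB_congr h7b, (cas_congr h7b).2.1] at hPh1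
  rw [rhoB_congr h7b, (cas_congr h7b).2.2] at hP1
  rw [rhoB_congr hDb, (cas_congr hDb).1] at hQ3
  rw [rhoB_congr hDb, (cas_congr hDb).2.1] at hPh3
  rw [rhoB_congr hDb, (cas_congr hDb).2.2] at hP3
  unfold DictFourTerm
  rw [hQ0, hPh0, hP0, hQ1, hPh1, hP1, hQ3, hPh3, hP3, hUW0, hUV0, hUW1, hUV1, hUW3, hUV3, hγ0]
  refine ⟨by ring, by ring, ?_⟩
  rw [zero_mul, add_zero]
  exact face_assemble hface R3 R1 hFd X7 XD hα hβ hδ hdq hs7 hm3 hm4 hm5 hm6 hF0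

/-- **The ghost-face stratum of gen-1's `DictBridge` follows from the face recurrences `CasVWFace16`** (a CONDITIONAL
edge: it credits the node `DictBridgeFace16` only modulo the open node `CasVWFace16`). -/
theorem dictBridgeFace16_of (hX : CasVWFace16) : DictBridgeFace16 :=
  fun a j₀ j₁ j₂ j₃ h16 H₀ H₁ H₂ H₃ => dictBridge_face16_at hX a j₀ j₁ j₂ j₃ h16 H₀ H₁ H₂ H₃

end Summit.KontsevichZagierPeriods.Zeta5Search.Elimination
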